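import Mathlib
import Literature.Probability.Process.PointStationaryLaw
import Literature.MathematicalPhysics.StatisticalMechanics.LennardJonesClusters
import HarnessLib

/-!
# Hard-core (uniformly separated) rooted configurations of `ℝ³`: counting and Lennard-Jones sums

Support file for item `stmt-AtomisticToContinuum-9229` (`UnimodularEnergyLowerBound`, route
`PalmUnimodularRigidity`).  Deterministic facts about a `δ`-separated point set `S ⊂ ℝ³`
(`∀ x y ∈ S, x ≠ y → δ ≤ dist x y`, `0 < δ`) and its counting measure `count|S`, the encoding of
rooted hard-core configurations used by `Literature.Probability.Process.IsRootedHardCore`: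

* packing: a finite subset of `S` inside a closed ball of radius `r` has at most `(2r/δ+1)³`
  points (`card_le_of_subset_closedBall`, from the tree's `card_le_of_separated_of_dist_le`);
  hence `S` meets every ball in a finite set and is countable;
* `count|S` of a ball is finite, and non-zero as soon as the ball contains the root `0 ∈ S`;
* `∫⁻ f d(count|S) = ∑' y : S, f y`;
* the Lennard-Jones sums seen from a point `y ∈ S` are uniformly bounded:
  `∑_{z ∈ S} V_LJ(‖z - y‖)⁻ ≤ 250/6 · δ⁻⁶` and `∑_{z ∈ S} V_LJ(‖z - y‖)⁺ ≤ 250/12 · δ⁻¹²`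
  (as `lintegral`s of `ENNReal.ofReal (∓ lennardJones ‖z - y‖)`), from the shell bound
  `sum_inv_pow_six_le` of `LennardJonesClusters.lean`.

All `[folklore]`.
-/

noncomputable section

namespace Summit.AtomisticToContinuum.Crystallization.Theorems.UnimodularEnergy

open MeasureTheory Metric Set Filter
open scoped ENNReal Topology
open Literature.MathematicalPhysics.StatisticalMechanics Literature.Probability.Process

local notation "E3" => EuclideanSpace ℝ (Fin 3)

section Separated

variable {δ : ℝ} {S : Set E3}

/-- **Packing.** A finite set of points of a `δ`-separated set `S ⊂ ℝ³` contained in the closed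
ball of radius `r ≥ 0` about `p` has at most `(2r/δ + 1)³` elements. [folklore] -/
theorem card_le_of_subset_closedBall (hδ : 0 < δ)
    (hsep : ∀ x ∈ S, ∀ y ∈ S, x ≠ y → δ ≤ dist x y) {p : E3} {r : ℝ} (hr : 0 ≤ r)
    (T : Finset E3) (hT : (↑T : Set E3) ⊆ S ∩ closedBall p r) :
    (T.card : ℝ) ≤ (2 * r / δ + 1) ^ 3 := by
  have h := card_le_of_separated_of_dist_le T p hδ hr
    (fun c hc => mem_closedBall.1 (hT hc).2)
    (fun c hc d hd hcd => hsep c (hT hc).1 d (hT hd).1 hcd)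
  simpa [finrank_euclideanSpace_fin] using h

/-- A `δ`-separated set meets every closed ball in a finite set. [folklore] -/
theorem finite_inter_closedBall (hδ : 0 < δ)
    (hsep : ∀ x ∈ S, ∀ y ∈ S, x ≠ y → δ ≤ dist x y) (p : E3) (r : ℝ) :
    (S ∩ closedBall p r).Finite := by
  by_contra hinf
  rcases lt_or_ge r 0 with hr | hr
  · rw [closedBall_eq_empty.2 hr, inter_empty] at hinf
    exact hinf finite_empty
  obtain ⟨T, hT, hcard⟩ :=
    (show (S ∩ closedBall p r).Infinite from hinf).exists_subset_card_eq
      (⌈(2 * r / δ + 1) ^ 3⌉₊ + 1)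
  have h1 := card_le_of_subset_closedBall hδ hsep hr T hT
  have h2 : ((2 * r / δ + 1) ^ 3 : ℝ) < T.card := by
    rw [hcard]
    push_cast
    exact (Nat.le_ceil _).trans_lt (lt_add_one _)
  linarith

/-- A `δ`-separated set meets every open ball in a finite set. [folklore] -/
theorem finite_inter_ball (hδ : 0 < δ)
    (hsep : ∀ x ∈ S, ∀ y ∈ S, x ≠ y → δ ≤ dist x y) (p : E3) (r : ℝ) :
    (S ∩ ball p r).Finite :=
  (finite_inter_closedBall hδ hsep p r).subset (inter_subset_inter_right _ ball_subset_closedBall)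

/-- A `δ`-separated set meets every open ball in a finite set (ball on the left). [folklore] -/
theorem finite_ball_inter (hδ : 0 < δ)
    (hsep : ∀ x ∈ S, ∀ y ∈ S, x ≠ y → δ ≤ dist x y) (p : E3) (r : ℝ) :
    (ball p r ∩ S).Finite := by
  rw [inter_comm]; exact finite_inter_ball hδ hsep p r

/-- A `δ`-separated subset of `ℝ³` is countable. [folklore] -/
theorem countable_of_separated (hδ : 0 < δ)
    (hsep : ∀ x ∈ S, ∀ y ∈ S, x ≠ y → δ ≤ dist x y) : S.Countable := by
  have : S = ⋃ n : ℕ, S ∩ closedBall 0 n := by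
    ext x
    simp only [mem_iUnion, mem_inter_iff, mem_closedBall, dist_zero_right]
    exact ⟨fun hx => ⟨⌈‖x‖⌉₊, hx, Nat.le_ceil _⟩, fun ⟨n, hx, _⟩ => hx⟩
  rw [this]
  exact countable_iUnion fun n => (finite_inter_closedBall hδ hsep 0 n).countable

end Separated

/-! ### The counting measure of a separated set -/

section Count

variable {δ : ℝ} {S : Set E3}

/-- `∫⁻ f d(count|S) = ∑' y : S, f y` for countable `S`. [folklore] -/
theorem lintegral_count_restrict (hS : S.Countable) (f : E3 → ℝ≥0∞) :
    ∫⁻ y, f y ∂((Measure.count : Measure E3).restrict S) = ∑' y : S, f y := by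
  rw [lintegral_countable f hS]
  simp

/-- `count|S` of a measurable set `A` is the counting measure of `A ∩ S`. [folklore] -/
theorem count_restrict_apply {A : Set E3} (hA : MeasurableSet A) :
    (Measure.count : Measure E3).restrict S A = Measure.count (A ∩ S) :=
  Measure.restrict_apply hA

/-- `count|S` of a ball is finite for `δ`-separated `S`. [folklore] -/
theorem count_restrict_ball_ne_top (hδ : 0 < δ)
    (hsep : ∀ x ∈ S, ∀ y ∈ S, x ≠ y → δ ≤ dist x y) (p : E3) (r : ℝ) :
    (Measure.count : Measure E3).restrict S (ball p r) ≠ ∞ := by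
  rw [count_restrict_apply measurableSet_ball]
  exact (Measure.count_apply_lt_top.2 (finite_ball_inter hδ hsep p r)).ne

/-- `count|S` of a ball containing a point of `S` is non-zero. [folklore] -/
theorem count_restrict_ball_ne_zero {p x : E3} {r : ℝ} (hx : x ∈ S) (hxp : x ∈ ball p r) :
    (Measure.count : Measure E3).restrict S (ball p r) ≠ 0 := by
  rw [count_restrict_apply measurableSet_ball]
  exact Measure.count_ne_zero ⟨x, hxp, hx⟩

/-- `count|S`-almost every point lies in `S`. [folklore] -/
theorem ae_mem_count_restrict (hS : S.Countable) :
    ∀ᵐ y ∂((Measure.count : Measure E3).restrict S), y ∈ S := by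
  rw [ae_iff, Measure.restrict_apply' hS.measurableSet, Measure.count_eq_zero_iff]
  ext x
  simp

end Count

/-! ### Lennard-Jones sums over separated sets -/

section LJ

variable {δ : ℝ} {S : Set E3}

/-- `V_LJ(r)⁻ ≤ r⁻⁶/6`. [folklore] -/
theorem ofReal_neg_lennardJones_le (r : ℝ) :
    ENNReal.ofReal (-lennardJones r) ≤ ENNReal.ofReal ((1 / 6) * r⁻¹ ^ 6) := by
  apply ENNReal.ofReal_le_ofReal
  have : 0 ≤ (1 / 12) * (r⁻¹) ^ 12 := by positivity
  unfold lennardJones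
  linarith

/-- `V_LJ(r)⁺ ≤ δ⁻⁶ r⁻⁶ / 12` for `r ≥ δ > 0`. [folklore] -/
theorem ofReal_lennardJones_le (hδ : 0 < δ) {r : ℝ} (hr : δ ≤ r) :
    ENNReal.ofReal (lennardJones r) ≤ ENNReal.ofReal ((1 / 12) * δ⁻¹ ^ 6 * r⁻¹ ^ 6) := by
  apply ENNReal.ofReal_le_ofReal
  have hr0 : 0 < r := hδ.trans_le hr
  have h1 : r⁻¹ ^ 6 ≤ δ⁻¹ ^ 6 :=
    pow_le_pow_left₀ (inv_nonneg.2 hr0.le) ((inv_le_inv₀ hr0 hδ).2 hr) 6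
  have h2 : 0 ≤ r⁻¹ ^ 6 := by positivity
  have h3 : (r⁻¹) ^ 12 = (r⁻¹) ^ 6 * (r⁻¹) ^ 6 := by ring
  unfold lennardJones
  rw [h3]
  nlinarith [mul_le_mul_of_nonneg_right h1 h2]

/-- **Shell bound, finite form**: for a finite `δ`-separated set `T ∋ y`,
`∑_{z ∈ T, z ≠ y} (dist y z)⁻⁶ ≤ 250 δ⁻⁶` (the tree's `sum_inv_pow_six_le`, re-indexed from
`Fin n` to a `Finset`). [folklore] -/
theorem sum_erase_inv_pow_six_le (hδ : 0 < δ) (T : Finset E3)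
    (hsep : ∀ x ∈ T, ∀ z ∈ T, x ≠ z → δ ≤ dist x z) {y : E3} (hy : y ∈ T) :
    ∑ z ∈ T.erase y, (dist y z)⁻¹ ^ 6 ≤ 250 * δ⁻¹ ^ 6 := by
  classical
  set e : {z // z ∈ T} ≃ Fin T.card := T.equivFin with he
  set x : Fin T.card → E3 := fun i => (e.symm i : E3) with hx
  have hxsep : ∀ k l, k ≠ l → δ ≤ dist (x k) (x l) := fun k l hkl =>
    hsep _ (e.symm k).2 _ (e.symm l).2 fun h => hkl (e.symm.injective (Subtype.ext h))
  have h := sum_inv_pow_six_le x hδ hxsep (e ⟨y, hy⟩)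
  have hxy : x (e ⟨y, hy⟩) = y := by simp [hx]
  rw [hxy] at h
  refine le_trans (le_of_eq ?_) h
  refine Finset.sum_bij' (fun z hz => e ⟨z, (Finset.mem_erase.1 hz).2⟩)
    (fun k _ => (e.symm k : E3)) ?_ ?_ ?_ ?_ ?_
  · intro z hz
    refine Finset.mem_erase.2 ⟨fun h' => (Finset.mem_erase.1 hz).1 ?_, Finset.mem_univ _⟩
    have := congrArg (fun i => (e.symm i : E3)) h'
    simpa using this
  · intro k hk
    refine Finset.mem_erase.2 ⟨fun h' => (Finset.mem_erase.1 hk).1 ?_, (e.symm k).2⟩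
    have : e.symm k = ⟨y, hy⟩ := Subtype.ext h'
    rw [← this, Equiv.apply_symm_apply]
  · intro z hz
    simp
  · intro k hk
    simp
  · intro z hz
    simp [hx]

/-- **Negative-part Lennard-Jones sum from a point of a separated set**:
`∑_{z ∈ S} V_LJ(‖z - y‖)⁻ ≤ 250/6 · δ⁻⁶` for `δ`-separated `S ∋ y`. [folklore] -/
theorem lintegral_ofReal_neg_lennardJones_le (hδ : 0 < δ)
    (hsep : ∀ x ∈ S, ∀ y ∈ S, x ≠ y → δ ≤ dist x y) {y : E3} (hy : y ∈ S) :
    ∫⁻ z, ENNReal.ofReal (-lennardJones ‖z - y‖) ∂((Measure.count : Measure E3).restrict S) ≤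
      ENNReal.ofReal (250 / 6 * δ⁻¹ ^ 6) := by
  classical
  rw [lintegral_count_restrict (countable_of_separated hδ hsep), ENNReal.tsum_eq_iSup_sum]
  refine iSup_le fun T' => ?_
  set T : Finset E3 := insert y (T'.map (Function.Embedding.subtype (· ∈ S))) with hT
  have hTS : ∀ z ∈ T, z ∈ S := by
    intro z hz
    rcases Finset.mem_insert.1 hz with rfl | hz
    · exact hy
    · obtain ⟨w, -, rfl⟩ := Finset.mem_map.1 hz
      exact w.2
  have hsepT : ∀ x ∈ T, ∀ z ∈ T, x ≠ z → δ ≤ dist x z := fun x hx z hz hxz =>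
    hsep x (hTS x hx) z (hTS z hz) hxz
  have hyT : y ∈ T := Finset.mem_insert_self _ _
  calc ∑ z ∈ T', ENNReal.ofReal (-lennardJones ‖(z : E3) - y‖)
      = ∑ z ∈ T'.map (Function.Embedding.subtype (· ∈ S)),
          ENNReal.ofReal (-lennardJones ‖z - y‖) := by
        rw [Finset.sum_map]; rfl
    _ ≤ ∑ z ∈ T, ENNReal.ofReal (-lennardJones ‖z - y‖) :=
        Finset.sum_le_sum_of_subset (Finset.subset_insert _ _)
    _ = ∑ z ∈ T.erase y, ENNReal.ofReal (-lennardJones ‖z - y‖) := by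
        rw [← Finset.add_sum_erase T _ hyT]
        simp [lennardJones_zero]
    _ ≤ ∑ z ∈ T.erase y, ENNReal.ofReal ((1 / 6) * (dist y z)⁻¹ ^ 6) :=
        Finset.sum_le_sum fun z _ => by
          rw [← dist_eq_norm, dist_comm]; exact ofReal_neg_lennardJones_le _
    _ = ENNReal.ofReal (∑ z ∈ T.erase y, (1 / 6) * (dist y z)⁻¹ ^ 6) :=
        (ENNReal.ofReal_sum_of_nonneg fun z _ => by positivity).symm
    _ ≤ ENNReal.ofReal (250 / 6 * δ⁻¹ ^ 6) := by
        apply ENNReal.ofReal_le_ofReal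
        rw [← Finset.mul_sum]
        nlinarith [sum_erase_inv_pow_six_le hδ T hsepT hyT]

/-- **Positive-part Lennard-Jones sum from a point of a separated set**:
`∑_{z ∈ S} V_LJ(‖z - y‖)⁺ ≤ 250/12 · δ⁻¹²` for `δ`-separated `S ∋ y` (the root term vanishes,
`V_LJ(0) = 0`). [folklore] -/
theorem lintegral_ofReal_lennardJones_le (hδ : 0 < δ)
    (hsep : ∀ x ∈ S, ∀ y ∈ S, x ≠ y → δ ≤ dist x y) {y : E3} (hy : y ∈ S) :
    ∫⁻ z, ENNReal.ofReal (lennardJones ‖z - y‖) ∂((Measure.count : Measure E3).restrict S) ≤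
      ENNReal.ofReal (250 / 12 * δ⁻¹ ^ 12) := by
  classical
  rw [lintegral_count_restrict (countable_of_separated hδ hsep), ENNReal.tsum_eq_iSup_sum]
  refine iSup_le fun T' => ?_
  set T : Finset E3 := insert y (T'.map (Function.Embedding.subtype (· ∈ S))) with hT
  have hTS : ∀ z ∈ T, z ∈ S := by
    intro z hz
    rcases Finset.mem_insert.1 hz with rfl | hz
    · exact hy
    · obtain ⟨w, -, rfl⟩ := Finset.mem_map.1 hz
      exact w.2
  have hsepT : ∀ x ∈ T, ∀ z ∈ T, x ≠ z → δ ≤ dist x z := fun x hx z hz hxz =>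
    hsep x (hTS x hx) z (hTS z hz) hxz
  have hyT : y ∈ T := Finset.mem_insert_self _ _
  calc ∑ z ∈ T', ENNReal.ofReal (lennardJones ‖(z : E3) - y‖)
      = ∑ z ∈ T'.map (Function.Embedding.subtype (· ∈ S)),
          ENNReal.ofReal (lennardJones ‖z - y‖) := by
        rw [Finset.sum_map]; rfl
    _ ≤ ∑ z ∈ T, ENNReal.ofReal (lennardJones ‖z - y‖) :=
        Finset.sum_le_sum_of_subset (Finset.subset_insert _ _)
    _ = ∑ z ∈ T.erase y, ENNReal.ofReal (lennardJones ‖z - y‖) := by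
        rw [← Finset.add_sum_erase T _ hyT]
        simp [lennardJones_zero]
    _ ≤ ∑ z ∈ T.erase y, ENNReal.ofReal ((1 / 12) * δ⁻¹ ^ 6 * (dist y z)⁻¹ ^ 6) :=
        Finset.sum_le_sum fun z hz => by
          rw [← dist_eq_norm, dist_comm]
          have hzy := Finset.mem_erase.1 hz
          exact ofReal_lennardJones_le hδ (hsepT y hyT z hzy.2 (Ne.symm hzy.1))
    _ = ENNReal.ofReal (∑ z ∈ T.erase y, (1 / 12) * δ⁻¹ ^ 6 * (dist y z)⁻¹ ^ 6) :=
        (ENNReal.ofReal_sum_of_nonneg fun z _ => by positivity).symm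
    _ ≤ ENNReal.ofReal (250 / 12 * δ⁻¹ ^ 12) := by
        apply ENNReal.ofReal_le_ofReal
        rw [← Finset.mul_sum]
        have h6 : (0 : ℝ) ≤ δ⁻¹ ^ 6 := by positivity
        have h12 : (δ⁻¹ ^ 12 : ℝ) = δ⁻¹ ^ 6 * δ⁻¹ ^ 6 := by ring
        rw [h12]
        nlinarith [sum_erase_inv_pow_six_le hδ T hsepT hyT,
          mul_le_mul_of_nonneg_left (sum_erase_inv_pow_six_le hδ T hsepT hyT) h6]

end LJ

end Summit.AtomisticToContinuum.Crystallization.Theorems.UnimodularEnergy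

end
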